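import Literature.NumberTheory.Transcendental.BakerLogarithmsAnalytic
import HarnessLib

/-!
# An interpolation (extrapolation) estimate for entire functions of one variable

Topic `Literature/NumberTheory/Transcendental` (trunk T-TRANSCEND). Decomposition step for the
named fact `Literature.NumberTheory.Transcendental.Diaz1989_thm1` (`DiazMain.lean`): step (c) of §II-3-2 of G. Diaz,
J. Number Theory 31 (1989), pp. 9–10, extrapolates the smallness of the one-variable entire function
`F̃` from the points `μ.v`, `|μ| < M`, to the disc `|z| ≤ r` by an interpolation formula (there:
E. Reyssat, Bull. Soc. Math. France 108 (1980), Lemme 4.5). We prove a version with the same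
architecture and explicit constants, by Lagrange interpolation and the maximum modulus principle
(as packaged in `BakerLogarithmsAnalytic.lean`); the Lagrange interpolation helpers are private
(they are the functions `z ↦ (Lagrange.basis E id e).eval z`, `(Lagrange.interpolate E id f).eval z`
of Mathlib's `LinearAlgebra/Lagrange.lean`), only the estimate is exported:

`norm_le_of_small_on_finset`: let `f` be entire, `E` a finite non-empty set of points of modulus
`≤ r`, `0 < r < R`, `|f| ≤ B` on `|z| = R`, `|f| ≤ ε` on `E`, and `∏_{e' ∈ E, e' ≠ e} |e - e'| ≥ Λ > 0`
for every `e ∈ E`. Then for `|w| ≤ r`, with `S = #E`,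
`|f(w)| ≤ S ε (2r)^{S-1}/Λ + (2r/(R-r))^S · (B + S ε (R+r)^{S-1}/Λ)`.

(Proof: `f - L_f`, `L_f` the Lagrange interpolation polynomial of `f` on `E`, vanishes on `E`, so
`|f - L_f|(w) ≤ (sup_{|z|=R} |f - L_f| / inf_{|z|=R} |p|) · |p(w)|`, `p(z) = ∏_{e ∈ E} (z - e)`, by the
maximum modulus principle applied to `(f - L_f)/p`; and `|L_f(z)| ≤ S ε (|z| + r)^{S-1}/Λ`.)
Everything here is proved.

## References

* G. Diaz, *Grands degrés de transcendance pour des familles d'exponentielles*, J. Number Theory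
  31 (1989), 1–23, §II-3-2 (c), pp. 9–10.
* E. Reyssat, *Approximation algébrique de nombres liés aux fonctions elliptiques et
  exponentielle*, Bull. Soc. Math. France 108 (1980), 47–79, Lemme 4.5 (the source's version).
-/

noncomputable section

open Complex Metric Finset

namespace Literature.NumberTheory.Transcendental

namespace Interp

/-- The Lagrange basis function `ℓ_e(z) = ∏_{e' ∈ E ∖ {e}} (z - e')/(e - e')` (as a function; this is
`(Lagrange.basis E id e).eval z` of Mathlib — kept private, only the final estimate is exported).
[folklore] -/
private def lagrangeBasis (E : Finset ℂ) (e z : ℂ) : ℂ := ∏ e' ∈ E.erase e, (z - e') / (e - e')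

/-- The Lagrange interpolation polynomial `L_f(z) = ∑_{e ∈ E} f(e) ℓ_e(z)` (as a function).
[folklore] -/
private def lagrangeInterp (E : Finset ℂ) (f : ℂ → ℂ) (z : ℂ) : ℂ := ∑ e ∈ E, f e * lagrangeBasis E e z

/-- `ℓ_e(e) = 1`. [folklore] -/
private theorem lagrangeBasis_self (E : Finset ℂ) (e : ℂ) : lagrangeBasis E e e = 1 := by
  unfold lagrangeBasis
  refine prod_eq_one fun e' he' => ?_
  have hne : e - e' ≠ 0 := sub_ne_zero.mpr (ne_of_mem_erase he').symm
  exact div_self hne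

/-- `ℓ_e(e'') = 0` for `e'' ∈ E`, `e'' ≠ e`. [folklore] -/
private theorem lagrangeBasis_of_ne (E : Finset ℂ) {e e'' : ℂ} (he'' : e'' ∈ E) (hne : e'' ≠ e) :
    lagrangeBasis E e e'' = 0 := by
  unfold lagrangeBasis
  exact prod_eq_zero (mem_erase.mpr ⟨hne, he''⟩) (by simp)

/-- `L_f` interpolates `f` on `E`. [folklore] -/
private theorem lagrangeInterp_apply_mem (E : Finset ℂ) (f : ℂ → ℂ) {e : ℂ} (he : e ∈ E) :
    lagrangeInterp E f e = f e := by
  unfold lagrangeInterp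
  rw [sum_eq_single e]
  · rw [lagrangeBasis_self, mul_one]
  · intro e' he' hne
    rw [lagrangeBasis_of_ne E he (Ne.symm hne), mul_zero]
  · intro h
    exact absurd he h

/-- `ℓ_e` is entire. [folklore] -/
private theorem differentiable_lagrangeBasis (E : Finset ℂ) (e : ℂ) :
    Differentiable ℂ (lagrangeBasis E e) := by
  have : lagrangeBasis E e = fun z => ∏ e' ∈ E.erase e, (z - e') / (e - e') := rfl
  rw [this]
  refine Differentiable.fun_finsetProd fun e' _ => ?_
  exact (differentiable_id.sub_const e').div_const _

/-- `L_f` is entire. [folklore] -/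
private theorem differentiable_lagrangeInterp (E : Finset ℂ) (f : ℂ → ℂ) :
    Differentiable ℂ (lagrangeInterp E f) := by
  have : lagrangeInterp E f = fun z => ∑ e ∈ E, f e * lagrangeBasis E e z := rfl
  rw [this]
  refine Differentiable.fun_sum fun e _ => ?_
  exact (differentiable_const _).mul (differentiable_lagrangeBasis E e)

/-- Bound for the Lagrange basis: if all points of `E` have modulus `≤ r` and
`∏_{e' ≠ e} |e - e'| ≥ Λ > 0`, then `|ℓ_e(z)| ≤ (|z| + r)^{#E - 1}/Λ` for `e ∈ E`. [folklore] -/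
private theorem norm_lagrangeBasis_le (E : Finset ℂ) {e : ℂ} (he : e ∈ E) {r Λ : ℝ} (hr : 0 ≤ r)
    (hEr : ∀ e' ∈ E, ‖e'‖ ≤ r) (hΛ : 0 < Λ) (hprod : Λ ≤ ∏ e' ∈ E.erase e, ‖e - e'‖) (z : ℂ) :
    ‖lagrangeBasis E e z‖ ≤ (‖z‖ + r) ^ (E.card - 1) / Λ := by
  unfold lagrangeBasis
  rw [prod_div_distrib, norm_div, norm_prod, norm_prod]
  have hcard : (E.erase e).card = E.card - 1 := card_erase_of_mem he
  rw [div_le_div_iff₀ (lt_of_lt_of_le hΛ hprod) hΛ]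
  have hnum : ∏ e' ∈ E.erase e, ‖z - e'‖ ≤ (‖z‖ + r) ^ (E.card - 1) := by
    rw [← hcard, ← prod_const]
    refine prod_le_prod (fun _ _ => norm_nonneg _) fun e' he' => ?_
    calc ‖z - e'‖ ≤ ‖z‖ + ‖e'‖ := norm_sub_le _ _
      _ ≤ ‖z‖ + r := by linarith [hEr e' (mem_of_mem_erase he')]
  calc (∏ e' ∈ E.erase e, ‖z - e'‖) * Λ ≤ (‖z‖ + r) ^ (E.card - 1) * Λ :=
        mul_le_mul_of_nonneg_right hnum hΛ.le
    _ ≤ (‖z‖ + r) ^ (E.card - 1) * ∏ e' ∈ E.erase e, ‖e - e'‖ :=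
        mul_le_mul_of_nonneg_left hprod (by positivity)

/-- Bound for the interpolation polynomial: `|L_f(z)| ≤ #E · ε · (|z| + r)^{#E-1}/Λ` when
`|f| ≤ ε` on `E`. [folklore] -/
private theorem norm_lagrangeInterp_le (E : Finset ℂ) (f : ℂ → ℂ) {r Λ ε : ℝ} (hr : 0 ≤ r)
    (hEr : ∀ e' ∈ E, ‖e'‖ ≤ r) (hΛ : 0 < Λ) (hprod : ∀ e ∈ E, Λ ≤ ∏ e' ∈ E.erase e, ‖e - e'‖)
    (hfE : ∀ e ∈ E, ‖f e‖ ≤ ε) (z : ℂ) :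
    ‖lagrangeInterp E f z‖ ≤ E.card * ε * (‖z‖ + r) ^ (E.card - 1) / Λ := by
  unfold lagrangeInterp
  have hε : ∀ e ∈ E, 0 ≤ ε := fun e he => (norm_nonneg _).trans (hfE e he)
  calc ‖∑ e ∈ E, f e * lagrangeBasis E e z‖ ≤ ∑ e ∈ E, ‖f e * lagrangeBasis E e z‖ :=
        norm_sum_le _ _
    _ ≤ ∑ e ∈ E, ε * ((‖z‖ + r) ^ (E.card - 1) / Λ) := by
        refine sum_le_sum fun e he => ?_
        rw [norm_mul]
        exact mul_le_mul (hfE e he) (norm_lagrangeBasis_le E he hr hEr hΛ (hprod e he) z)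
          (norm_nonneg _) (hε e he)
    _ = E.card * ε * (‖z‖ + r) ^ (E.card - 1) / Λ := by
        rw [sum_const, nsmul_eq_mul]
        ring

/-- **Interpolation estimate** (the architecture of Diaz 1989, §II-3-2 (c) / Reyssat 1980,
Lemme 4.5, with explicit constants). Let `f` be entire, `E ≠ ∅` a finite set of points of modulus
`≤ r`, `0 < r < R`, `|f(z)| ≤ B` for `|z| = R`, `|f(e)| ≤ ε` for `e ∈ E`, and
`∏_{e' ∈ E ∖ {e}} |e - e'| ≥ Λ > 0` for all `e ∈ E`. Then for `|w| ≤ r`, with `S = #E`,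
`|f(w)| ≤ S ε (2r)^{S-1}/Λ + (2r/(R-r))^S (B + S ε (R+r)^{S-1}/Λ)`.
[cite: Diaz1989, §II-3-2 (c) pp. 9–10 (interpolation formula, after Reyssat 1980 Lemme 4.5)] -/
theorem norm_le_of_small_on_finset {f : ℂ → ℂ} (hf : Differentiable ℂ f) (E : Finset ℂ)
    (hE : E.Nonempty) {r R B ε Λ : ℝ} (hr : 0 < r) (hrR : r < R)
    (hEr : ∀ e ∈ E, ‖e‖ ≤ r) (hfR : ∀ z : ℂ, ‖z‖ = R → ‖f z‖ ≤ B) (hfE : ∀ e ∈ E, ‖f e‖ ≤ ε)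
    (hΛ : 0 < Λ) (hprod : ∀ e ∈ E, Λ ≤ ∏ e' ∈ E.erase e, ‖e - e'‖) {w : ℂ} (hw : ‖w‖ ≤ r) :
    ‖f w‖ ≤ E.card * ε * (2 * r) ^ (E.card - 1) / Λ +
      (2 * r / (R - r)) ^ E.card * (B + E.card * ε * (R + r) ^ (E.card - 1) / Λ) := by
  have hR : 0 < R := hr.trans hrR
  have hRr : 0 < R - r := sub_pos.mpr hrR
  obtain ⟨e₀, he₀⟩ := hE
  have hε : 0 ≤ ε := (norm_nonneg _).trans (hfE e₀ he₀)
  have hB : 0 ≤ B := by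
    have := hfR (R : ℂ) (by simp [hR.le])
    exact (norm_nonneg _).trans this
  -- `g = f - L_f` vanishes on `E`.
  set g : ℂ → ℂ := fun z => f z - lagrangeInterp E f z with hg
  have hgd : Differentiable ℂ g := hf.sub (differentiable_lagrangeInterp E f)
  have hgE : ∀ e ∈ E, g e = 0 := fun e he => by
    simp [hg, lagrangeInterp_apply_mem E f he]
  have hord : ∀ c ∈ E, ((1 : ℕ) : ℕ∞) ≤ analyticOrderAt g c := fun c hc =>
    Literature.NumberTheory.Transcendental.Baker1975.Analytic.le_analyticOrderAt_of_iteratedDeriv_eq_zero hgd fun j hj => by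
      have : j = 0 := by omega
      subst this
      simpa using hgE c hc
  -- Bounds on the circle `|z| = R`.
  set θ : ℝ := B + E.card * ε * (R + r) ^ (E.card - 1) / Λ with hθ
  have hθg : ∀ z ∈ sphere (0 : ℂ) R, ‖g z‖ ≤ θ := by
    intro z hz
    have hzR : ‖z‖ = R := by simpa using hz
    calc ‖g z‖ ≤ ‖f z‖ + ‖lagrangeInterp E f z‖ := norm_sub_le _ _
      _ ≤ B + E.card * ε * (‖z‖ + r) ^ (E.card - 1) / Λ :=
          add_le_add (hfR z hzR) (norm_lagrangeInterp_le E f hr.le hEr hΛ hprod hfE z)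
      _ = θ := by rw [hθ, hzR]
  have hm : 0 < (R - r) ^ (1 * E.card) := by positivity
  have hmF : ∀ z ∈ sphere (0 : ℂ) R, (R - r) ^ (1 * E.card) ≤ ‖∏ c ∈ E, (z - c) ^ 1‖ := by
    intro z hz
    have hzR : ‖z‖ = R := by simpa using hz
    refine Literature.NumberTheory.Transcendental.Baker1975.Analytic.le_norm_prod_pow E 1 hRr.le fun c hc => ?_
    calc R - r ≤ ‖z‖ - ‖c‖ := by rw [hzR]; linarith [hEr c hc]
      _ ≤ ‖z - c‖ := by
          have := norm_sub_norm_le z c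
          linarith [abs_le.mp (abs_norm_sub_norm_le z c) |>.2, norm_sub_norm_le z c]
  have hwR : ‖w‖ ≤ R := hw.trans hrR.le
  have hgw := Literature.NumberTheory.Transcendental.Baker1975.Analytic.norm_le_of_analyticOrderAt hgd E 1 hord hR hθg hm
    hmF hwR
  -- `|p(w)| ≤ (2r)^S`.
  have hpw : ‖∏ c ∈ E, (w - c) ^ 1‖ ≤ (2 * r) ^ (1 * E.card) :=
    Literature.NumberTheory.Transcendental.Baker1975.Analytic.norm_prod_pow_le E 1 fun c hc => by
      calc ‖w - c‖ ≤ ‖w‖ + ‖c‖ := norm_sub_le _ _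
        _ ≤ 2 * r := by linarith [hEr c hc]
  simp only [one_mul] at hgw hpw hm
  have hθ0 : 0 ≤ θ := by rw [hθ]; positivity
  have hgw' : ‖g w‖ ≤ (2 * r / (R - r)) ^ E.card * θ := by
    calc ‖g w‖ ≤ θ / (R - r) ^ E.card * ‖∏ c ∈ E, (w - c) ^ 1‖ := hgw
      _ ≤ θ / (R - r) ^ E.card * (2 * r) ^ E.card :=
          mul_le_mul_of_nonneg_left hpw (div_nonneg hθ0 hm.le)
      _ = (2 * r / (R - r)) ^ E.card * θ := by rw [div_pow]; field_simp
  -- `|L_f(w)| ≤ S ε (2r)^{S-1}/Λ`.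
  have hLw : ‖lagrangeInterp E f w‖ ≤ E.card * ε * (2 * r) ^ (E.card - 1) / Λ := by
    refine (norm_lagrangeInterp_le E f hr.le hEr hΛ hprod hfE w).trans ?_
    have h2 : (‖w‖ + r) ^ (E.card - 1) ≤ (2 * r) ^ (E.card - 1) :=
      pow_le_pow_left₀ (by positivity) (by linarith) _
    have hnum : (E.card : ℝ) * ε * (‖w‖ + r) ^ (E.card - 1) ≤ E.card * ε * (2 * r) ^ (E.card - 1) :=
      mul_le_mul_of_nonneg_left h2 (by positivity)
    exact div_le_div_of_nonneg_right hnum hΛ.le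
  calc ‖f w‖ = ‖lagrangeInterp E f w + g w‖ := by simp [hg]
    _ ≤ ‖lagrangeInterp E f w‖ + ‖g w‖ := norm_add_le _ _
    _ ≤ E.card * ε * (2 * r) ^ (E.card - 1) / Λ + (2 * r / (R - r)) ^ E.card * θ :=
        add_le_add hLw hgw'

end Interp

end Literature.NumberTheory.Transcendental

end
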